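import Summits.QuantumAdvantage.QuantumAdvantage.Theorems.CubicForrelationNearExactIsExactTwelveTypeO935

/-!
# Crux `CubicForrelation.NearExactIsExact` (stmt-QuantumAdvantage-14043) — n = 12, type O below `935/1024`: a cubic support of `912` points has no
  two distinct non-zero periods (coordinate restriction with an explicit chart; Ax on 10 bits)

Certificate seat `b2b-cforr-cert` (gen 18).  HONEST FRAMING: elementary coding-theory bricks (standard axioms) for the type-O branch of the rung
`934/1024` (there the base set `E`, `#E = 912`, turns out to be invariant under the translations by the differences of the 8-point wild set —
see HOME/b2b-cforr-cert-g18/PROOF-N12-935.md); NO new value of `θ₁₂`.  NOT summit progress.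
* `to18_coord_restrict`: the restriction of a degree-`≤ d` function on `k + 1` bits to the coordinate hyperplane `{x_{i₀} = b}`, read through
  the chart `y ↦ insertNth i₀ b y`, has degree `≤ d` and exactly `#{c = 1, x_{i₀} = b}` ones (gen 16's `ktg_restrict` for `z = e_{i₀}`, with
  the chart made explicit so that periods transfer).
* `to18_cubic_weight_ten_dvd`: weights of cubics on 10 bits are multiples of `8` (Ax / McEliece).
* `to18_period_halves`: a period `a` with `a_{i₀} = 1` splits the support evenly between `{x_{i₀} = 0}` and `{x_{i₀} = 1}`.
* `to18_no_two_periods_912`: a cubic `c` on 12 bits with `#{c = 1} = 912` cannot satisfy `c(x ⊕ a) = c(x) = c(x ⊕ b)` for two distinct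
  non-zero `a, b`: restricting along a pivot of `a` gives a cubic on 11 bits with `456` ones and still a non-zero period, restricting again a
  cubic on 10 bits with `228` ones — but `8 ∤ 228`.
References: Ax (1964) / McEliece (1972); MacWilliams–Sloane (1977) Ch. 13, 15.  Axioms: the standard three.
-/

set_option linter.dupNamespace false -- D-0017: single-problem summit ⇒ `QuantumAdvantage.QuantumAdvantage` by design

noncomputable section

namespace Summit.QuantumAdvantage.QuantumAdvantage.Theorems.CubicForrelation.NearExactIsExact

open Finset
open Literature.Computability.QuantumComplexity
open Literature.Computability.QuantumComplexity.BuzetChailloux (bxor zeroVec bxor_bxor_cancel_left bxor_zeroVec zeroVec_bxor bxor_comm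
  bxor_self twist_zeroVec_right)
open Literature.Computability.QuantumComplexity.DerivativeWalsh (W)

/-! ### Coordinate restriction with an explicit chart -/

/-- **Restriction to a coordinate hyperplane, explicit chart.**  For `c` of degree `≤ d` on `k + 1` bits, `i₀` and `b`, the function
`y ↦ c (insertNth i₀ b y)` on `k` bits has degree `≤ d` and `#{c = 1, x_{i₀} = b}` ones. [folklore; cf. `ktg_restrict`] -/
theorem to18_coord_restrict {k d : ℕ} (c : (Fin (k + 1) → Bool) → Bool) (hc : IsDegLeFun d c) (i₀ : Fin (k + 1)) (b : Bool) :
    IsDegLeFun d (fun y => c (Fin.insertNth (α := fun _ => Bool) i₀ b y)) ∧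
      #(univ.filter fun y => c (Fin.insertNth (α := fun _ => Bool) i₀ b y) = true) =
        #(univ.filter fun x => c x = true ∧ x i₀ = b) := by
  classical
  set s : (Fin k → Bool) → (Fin (k + 1) → Bool) := fun y => Fin.insertNth (α := fun _ => Bool) i₀ b y with hsdef
  have hs0 : ∀ y, s y i₀ = b := fun y => by simp [hsdef]
  have hsj : ∀ y (j : Fin k), s y (i₀.succAbove j) = y j := fun y j => by simp [hsdef]
  have hsr : ∀ x : Fin (k + 1) → Bool, x i₀ = b → s (Fin.removeNth (α := fun _ => Bool) i₀ x) = x := by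
    intro x hx
    simp only [hsdef]
    rw [← hx]
    exact Fin.insertNth_self_removeNth (α := fun _ => Bool) i₀ x
  refine ⟨?_, ?_⟩
  · refine nf_isDegLeFun_subst
      (Fin.insertNth (α := fun _ => MvPolynomial (Fin k) (ZMod 2)) i₀ (MvPolynomial.C (if b = true then (1 : ZMod 2) else 0))
        (fun j => MvPolynomial.X j)) (fun i => ?_) s (fun y i => ?_) hc
    · rcases Fin.eq_self_or_eq_succAbove i₀ i with hi | ⟨j, rfl⟩
      · rw [hi, Fin.insertNth_apply_same, MvPolynomial.totalDegree_C]; exact Nat.zero_le _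
      · rw [Fin.insertNth_apply_succAbove]
        exact (MvPolynomial.totalDegree_X (R := ZMod 2) j).le
    · rcases Fin.eq_self_or_eq_succAbove i₀ i with hi | ⟨j, rfl⟩
      · rw [hi, Fin.insertNth_apply_same, hs0, MvPolynomial.eval_C]
      · rw [Fin.insertNth_apply_succAbove, MvPolynomial.eval_X, hsj]
  · refine card_nbij' s (fun x => Fin.removeNth (α := fun _ => Bool) i₀ x) (fun y hy => ?_) (fun x hx => ?_)
      (fun y _ => Fin.removeNth_insertNth (α := fun _ => Bool) i₀ b y) (fun x hx => ?_)
    · rw [mem_coe, mem_filter] at hy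
      rw [mem_coe, mem_filter]
      exact ⟨mem_univ _, hy.2, hs0 y⟩
    · rw [mem_coe, mem_filter] at hx
      rw [mem_coe, mem_filter]
      refine ⟨mem_univ _, ?_⟩
      show c (s (Fin.removeNth (α := fun _ => Bool) i₀ x)) = true
      rw [hsr x hx.2.2]; exact hx.2.1
    · rw [mem_coe, mem_filter] at hx
      exact hsr x hx.2.2

/-- **Period transfer through the chart**: if `p_{i₀} = 0` then `insertNth i₀ b (y ⊕ p∘succAbove) = (insertNth i₀ b y) ⊕ p`. [folklore] -/
theorem to18_insertNth_bxor {k : ℕ} (i₀ : Fin (k + 1)) (b : Bool) (y : Fin k → Bool) (p : Fin (k + 1) → Bool) (hp : p i₀ = false) :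
    Fin.insertNth (α := fun _ => Bool) i₀ b (bxor y (fun j => p (i₀.succAbove j))) =
      bxor (Fin.insertNth (α := fun _ => Bool) i₀ b y) p := by
  funext i
  rcases Fin.eq_self_or_eq_succAbove i₀ i with hi | ⟨j, rfl⟩
  · rw [hi, Fin.insertNth_apply_same]
    show b = (Fin.insertNth (α := fun _ => Bool) i₀ b y i₀ ^^ p i₀)
    rw [Fin.insertNth_apply_same, hp, Bool.xor_false]
  · rw [Fin.insertNth_apply_succAbove]
    show (y j ^^ p (i₀.succAbove j)) = (Fin.insertNth (α := fun _ => Bool) i₀ b y (i₀.succAbove j) ^^ p (i₀.succAbove j))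
    rw [Fin.insertNth_apply_succAbove]

/-! ### Weights of cubics on 10 bits; halves under a period -/

/-- **Weights of cubics on 10 bits are multiples of `8`** (Ax / McEliece: `W(0) = 2¹⁰ − 2·wt ∈ 16ℤ`). [folklore] -/
theorem to18_cubic_weight_ten_dvd (e : (Fin 10 → Bool) → Bool) (he : IsDegLeFun 3 e) :
    8 ∣ #(univ.filter fun y => e y = true) := by
  classical
  obtain ⟨u, hu⟩ := tw_base (n := 10) e he 4 (by norm_num)
  have hW0 : W (fun y => signOf (e y)) zeroVec = 1024 - 2 * (#(univ.filter fun y => e y = true) : ℝ) := by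
    unfold W
    rw [sum_congr rfl fun y _ => by rw [twist_zeroVec_right, mul_one]]
    have e1 : ∀ y, signOf (e y) = 1 - 2 * (if e y = true then (1 : ℝ) else 0) := fun y => by
      unfold signOf; cases e y <;> norm_num
    rw [sum_congr rfl fun y _ => e1 y, sum_sub_distrib, sum_const, card_univ, Fintype.card_fun, Fintype.card_bool, Fintype.card_fin,
      ← mul_sum, sum_boole]
    norm_num
  have h := hu zeroVec
  rw [hW0] at h
  have h' : ((#(univ.filter fun y => e y = true) : ℕ) : ℝ) = 512 - 8 * (u zeroVec : ℝ) := by norm_num at h ⊢; linarith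
  have h'' : ((#(univ.filter fun y => e y = true) : ℕ) : ℤ) = 512 - 8 * u zeroVec := by exact_mod_cast h'
  have : (8 : ℤ) ∣ ((#(univ.filter fun y => e y = true) : ℕ) : ℤ) := ⟨64 - u zeroVec, by rw [h'']; ring⟩
  exact_mod_cast this

/-- **A period with a `1` at `i₀` splits the support evenly**: if `c(x ⊕ a) = c(x)` for all `x` and `a_{i₀} = 1`, then
`#{c = 1, x_{i₀} = 0} = #{c = 1, x_{i₀} = 1}` and both are half of `#{c = 1}`. [folklore] -/
theorem to18_period_halves {m : ℕ} (c : (Fin m → Bool) → Bool) (a : Fin m → Bool) (hper : ∀ x, c (bxor x a) = c x) (i₀ : Fin m)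
    (ha : a i₀ = true) :
    2 * #(univ.filter fun x => c x = true ∧ x i₀ = false) = #(univ.filter fun x => c x = true) := by
  classical
  have hsym : #(univ.filter fun x => c x = true ∧ x i₀ = false) = #(univ.filter fun x => c x = true ∧ x i₀ = true) := by
    refine card_nbij' (fun x => bxor x a) (fun x => bxor x a) (fun x hx => ?_) (fun x hx => ?_)
      (fun x _ => by simp [iw_bxor_assoc, bxor_self, bxor_zeroVec]) (fun x _ => by simp [iw_bxor_assoc, bxor_self, bxor_zeroVec])
    · rw [mem_coe, mem_filter] at hx ⊢
      refine ⟨mem_univ _, by rw [hper]; exact hx.2.1, ?_⟩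
      show (x i₀ ^^ a i₀) = true
      rw [hx.2.2, ha]; rfl
    · rw [mem_coe, mem_filter] at hx ⊢
      refine ⟨mem_univ _, by rw [hper]; exact hx.2.1, ?_⟩
      show (x i₀ ^^ a i₀) = false
      rw [hx.2.2, ha]; rfl
  have hsplit := card_filter_add_card_filter_not (s := univ.filter fun x : Fin m → Bool => c x = true) (fun x => x i₀ = false)
  rw [filter_filter, filter_filter] at hsplit
  have e : (univ.filter fun x : Fin m → Bool => c x = true ∧ ¬ x i₀ = false) = univ.filter fun x => c x = true ∧ x i₀ = true :=
    filter_congr fun x _ => by simp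
  rw [e, ← hsym] at hsplit
  omega

/-! ### No two distinct non-zero periods for a cubic support of `912` points -/

/-- **A cubic support of `912` points on 12 bits has no two distinct non-zero periods.**  See the module docstring. [this work] -/
theorem to18_no_two_periods_912 (c : (Fin (6 + 6) → Bool) → Bool) (hc : IsDegLeFun 3 c) (h912 : #(univ.filter fun x => c x = true) = 912)
    (a b : Fin (6 + 6) → Bool) (ha : a ≠ zeroVec) (hb : b ≠ zeroVec) (hab : a ≠ b)
    (hpa : ∀ x, c (bxor x a) = c x) (hpb : ∀ x, c (bxor x b) = c x) : False := by
  classical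
  -- a pivot of `a`, and a second period with a `0` at the pivot
  obtain ⟨i₀, hi₀⟩ : ∃ i, a i = true := by
    by_contra h
    push Not at h
    exact ha (funext fun i => by simpa [zeroVec] using h i)
  set b' : Fin (6 + 6) → Bool := if b i₀ = true then bxor b a else b with hb'def
  have hb'0 : b' i₀ = false := by
    by_cases h : b i₀ = true
    · simp only [hb'def, h, if_true]
      show (b i₀ ^^ a i₀) = false
      rw [h, hi₀]; rfl
    · simp only [hb'def, h]
      simpa using h
  have hb'ne : b' ≠ zeroVec := by
    by_cases h : b i₀ = true
    · simp only [hb'def, h, if_true]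
      intro hz
      apply hab
      funext i
      have := congrFun hz i
      change (b i ^^ a i) = false at this
      revert this
      cases a i <;> cases b i <;> simp
    · simp only [hb'def, h]; exact hb
  have hpb' : ∀ x, c (bxor x b') = c x := by
    intro x
    by_cases h : b i₀ = true
    · simp only [hb'def, h, if_true]
      rw [show bxor x (bxor b a) = bxor (bxor x b) a from (iw_bxor_assoc x b a).symm, hpa, hpb]
    · simp only [hb'def, h]; exact hpb x
  -- first restriction: a cubic on 11 bits with `456` ones, periodic under `b' ∘ succAbove`
  obtain ⟨hc₁, hcard₁⟩ := to18_coord_restrict (k := 11) c hc i₀ false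
  set c₁ : (Fin 11 → Bool) → Bool := fun y => c (Fin.insertNth (α := fun _ => Bool) i₀ false y) with hc₁def
  have hA : #(univ.filter fun x => c x = true ∧ x i₀ = false) = 456 := by
    have h2 := to18_period_halves c a hpa i₀ hi₀
    rw [h912] at h2
    omega
  have h456 : #(univ.filter fun y => c₁ y = true) = 456 := by
    change #(univ.filter fun y => c (Fin.insertNth (α := fun _ => Bool) i₀ false y) = true) = 456
    rw [hcard₁]
    convert hA using 2
  set p₁ : Fin 11 → Bool := fun j => b' (i₀.succAbove j) with hp₁def
  have hper₁ : ∀ y, c₁ (bxor y p₁) = c₁ y := by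
    intro y
    change c (Fin.insertNth (α := fun _ => Bool) i₀ false (bxor y (fun j => b' (i₀.succAbove j)))) =
      c (Fin.insertNth (α := fun _ => Bool) i₀ false y)
    rw [to18_insertNth_bxor i₀ false y b' hb'0, hpb']
  have hp₁ne : p₁ ≠ zeroVec := by
    intro hz
    apply hb'ne
    funext i
    rcases Fin.eq_self_or_eq_succAbove i₀ i with hi | ⟨j, rfl⟩
    · rw [hi, hb'0]; rfl
    · have := congrFun hz j
      exact this
  -- second restriction: a cubic on 10 bits with `228` ones
  obtain ⟨i₁, hi₁⟩ : ∃ i, p₁ i = true := by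
    by_contra h
    push Not at h
    exact hp₁ne (funext fun i => by simpa [zeroVec] using h i)
  obtain ⟨hc₂, hcard₂⟩ := to18_coord_restrict (k := 10) c₁ hc₁ i₁ false
  have hB : #(univ.filter fun x => c₁ x = true ∧ x i₁ = false) = 228 := by
    have h2 := to18_period_halves c₁ p₁ hper₁ i₁ hi₁
    rw [h456] at h2
    omega
  have h228 : #(univ.filter fun y => c₁ (Fin.insertNth (α := fun _ => Bool) i₁ false y) = true) = 228 := by
    rw [hcard₂]
    convert hB using 2
  have h8 := to18_cubic_weight_ten_dvd _ hc₂
  rw [h228] at h8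
  omega

end Summit.QuantumAdvantage.QuantumAdvantage.Theorems.CubicForrelation.NearExactIsExact

end
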